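import Mathlib
import Summits.NavierStokesRegularity.NavierStokesRegularity.Theorems.HeteroclinicTriggerChainTriggerChainFrontStepLatticeSeedShell
import Summits.NavierStokesRegularity.NavierStokesRegularity.Theorems.HeteroclinicTriggerChainTriggerChainFrontStepJunkEnvelope
import HarnessLib

/-!
# `HeteroclinicTriggerChain` — crux `TriggerChainFrontStep` (item stmt-NavierStokesRegularity-22785):
  TAIL STEP — one shell ahead of the front: carrier grows at most linearly, trigger by Grönwall

Envelope supply for the shells ahead of the front (the `Z`-type envelopes of the hop lemmas), one shell at
a time, for an exact flow `S` of `α₀ + βσ` (normal form, parity, `|α₀| ≤ 1`, `σ` symmetric with parity,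
`|σ| ≤ σ̄`):

* `htcTA_tail_carrier` — the carrier row is a sum of signed squares (`…CarrierRow`), so at shell `k`
  `|S_{i₀,k}(t)| ≤ |S_{i₀,k}(0)| + t·( 2^{5k/2}(2V_k² + 4ι²) + 2^{5(k−1)/2}(2U² + 2ι²) + βB_σ )`
  (`V_k ≥ |S_{i₁,k}|`, `U ≥ |S_{i₁,k−1}|`, `ι ≥` junk at shells `k−1, k`, no linear term: pure carriers
  are force-free);
* `htcTA_tail_trigger` — the seed row at shell `k` (`…LatticeSeedShell`) is `v′ = γ₀ey·v + γ₁βsxu + f_v`,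
  so `|S_{i₁,k}(t)| ≤ gronwallBound |S_{i₁,k}(0)| K src t` with `K = 2γ₀·Y` (`Y ≥ |S_{i₀,k}|`) and
  `src = 2γ₁βσ̄·X·U + Φ` (`X ≥ |S_{i₀,k−1}|`, `U ≥ |S_{i₁,k−1}|`, `Φ` the remainder bound of the seed row).

Iterating in `k` (each shell's sources are the shell below) is the tail induction the integrator runs.

HONEST FRAMING: statements about exact flows of Tao-type MODEL lattices (Tao 2016 §4) under envelope
hypotheses; helper for the crux (no stub credit); nothing here is a statement about the Navier–Stokes
equations; no summit, rung or crux is proved.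
-/

noncomputable section

set_option linter.dupNamespace false

open Real Set

namespace Summit.NavierStokesRegularity.NavierStokesRegularity.Theorems

open Literature.Analysis.FluidPDE Literature.Analysis.FluidPDE.TaoCascade

/-- **Tail carrier.** Exact flow of `α₀ + βσ` on `[0,T]` (normal form at `i₀`, `|α₀| ≤ 1`,
`e = d i₁ 0 ∈ (0,2]` via `|α₀| ≤ 1`, `g = e`), envelopes at shells `k−1, k`: `V ≥ |S_{i₁,k}|`,
`U ≥ |S_{i₁,k−1}|`, `ι ≥` junk, `B_σ ≥ |σ-row (i₀,k)|`. Then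
`|S_{i₀,k}(t)| ≤ |S_{i₀,k}(0)| + (2^{5k/2}(2V² + 4ι²) + 2^{5(k−1)/2}(2U² + 2ι²) + βB_σ)·t`. [this file] -/
theorem htcTA_tail_carrier (α₀ σ : Fin 4 → Fin 4 → Fin 4 → ℤ × ℤ × ℤ → ℝ) (i₀ i₁ : Fin 4)
    (d : Fin 4 → ℤ → ℝ) (hne : i₀ ≠ i₁)
    (hsym : IsSymmetricCoeff α₀) (hcanc : IsCancellingCoeff α₀)
    (hpure : ∀ X : Fin 4 → ℤ → ℝ → ℝ, (∀ i n t, i ≠ i₀ → X i n t = 0) →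
      ∀ i n t, quadTerm 1 α₀ X i n t = 0)
    (hsad : ∀ (Y : Fin 4 → ℤ → ℝ → ℝ) (i : Fin 4) (n : ℤ) (t : ℝ),
      quadTerm 1 α₀ (fun j m s => (fun j m (_ : ℝ) => if j = i₀ ∧ m = 0 then (1 : ℝ) else 0) j m s +
          Y j m s) i n t -
        quadTerm 1 α₀ (fun j m (_ : ℝ) => if j = i₀ ∧ m = 0 then (1 : ℝ) else 0) i n t -
        quadTerm 1 α₀ Y i n t = d i n * Y i n t)
    (hα1 : ∀ a b c μ, |α₀ a b c μ| ≤ 1)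
    (hg : α₀ i₁ i₁ i₀ (0, 0, 1) = d i₁ 0) (he : 0 < d i₁ 0)
    (β : ℝ) (hβ : 0 ≤ β) (S : Fin 4 → ℤ → ℝ → ℝ) {T : ℝ} (k : ℤ)
    (hS : ∀ i k, ∀ t ∈ Icc 0 T, HasDerivWithinAt (S i k)
      (quadTerm 1 α₀ S i k t + β * quadTerm 1 σ S i k t) (Icc 0 T) t)
    {V U ι Bσ : ℝ} (hι0 : 0 ≤ ι)
    (hV : ∀ t ∈ Icc 0 T, |S i₁ k t| ≤ V) (hU : ∀ t ∈ Icc 0 T, |S i₁ (k - 1) t| ≤ U)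
    (hι : ∀ t ∈ Icc 0 T, ∀ a, a ≠ i₀ → a ≠ i₁ → |S a k t| ≤ ι ∧ |S a (k - 1) t| ≤ ι)
    (hB : ∀ t ∈ Icc 0 T, |quadTerm 1 σ S i₀ k t| ≤ Bσ) :
    ∀ t ∈ Icc 0 T, |S i₀ k t| ≤ |S i₀ k 0| +
      ((1 + 1 : ℝ) ^ ((5 : ℝ) * k / 2) * (2 * V ^ 2 + 4 * ι ^ 2) +
        (1 + 1 : ℝ) ^ ((5 : ℝ) * ((k : ℝ) - 1) / 2) * (2 * U ^ 2 + 2 * ι ^ 2) + β * Bσ) * t := by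
  obtain ⟨nf1, -, -, nf4, -, -, nf7, -, -⟩ :=
    HeteroclinicTriggerChain.stub_normal_form α₀ i₀ d hsym hcanc hpure hsad
  have m001 : ((0 : ℤ), (0 : ℤ), (1 : ℤ)) ∈ shiftSet := by decide
  have hg0 : α₀ i₀ i₀ i₀ (0, 0, 1) = 0 := nf1 i₀ (0, 0, 1) m001
  have hd0 : d i₀ 0 = 0 := nf7 0
  have he2 : d i₁ 0 ≤ 2 := by
    rw [nf4 i₁]; have := (abs_le.1 (hα1 i₀ i₁ i₁ (0, 0, 0))).2; linarith
  have hda : ∀ a, |d a 0| ≤ 2 := fun a => by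
    rw [nf4 a, abs_mul, abs_two]; linarith [hα1 i₀ a a (0, 0, 0)]
  set γ₀ : ℝ := (1 + 1 : ℝ) ^ ((5 : ℝ) * k / 2) with hγ₀
  set γ₁ : ℝ := (1 + 1 : ℝ) ^ ((5 : ℝ) * ((k : ℝ) - 1) / 2) with hγ₁
  have hγ₀0 : 0 ≤ γ₀ := Real.rpow_nonneg (by norm_num) _
  have hγ₁0 : 0 ≤ γ₁ := Real.rpow_nonneg (by norm_num) _
  -- the carrier row has no linear term: p' = 0·p + src
  refine htcJE_dampedForcedOn_abs_le (p := S i₀ k) (c := fun _ => 0)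
    (src := fun t => quadTerm 1 α₀ S i₀ k t + β * quadTerm 1 σ S i₀ k t)
    (fun t ht => (hS i₀ k t ht).congr_deriv (by ring)) (fun t _ => le_rfl) (fun t ht => ?_)
  have hx := htcCR_quadTerm_carrier α₀ i₀ d hsym hcanc hpure hsad S k t
  have hjk : ∀ a, a ≠ i₀ → a ≠ i₁ → |S a k t| ≤ ι := fun a h0 h1 => (hι t ht a h0 h1).1
  have hjm : ∀ a, a ≠ i₀ → a ≠ i₁ → |S a (k - 1) t| ≤ ι := fun a h0 h1 => (hι t ht a h0 h1).2
  have hsq : ∀ {z : ℝ}, |z| ≤ ι → z ^ 2 ≤ ι ^ 2 := fun {z} hz => by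
    have := abs_nonneg z; nlinarith [sq_abs z]
  have hjd : ∀ (a : Fin 4) (z : ℝ), |z| ≤ ι → |d a 0 * z ^ 2| ≤ 2 * ι ^ 2 := fun a z hz => by
    rw [abs_mul, abs_of_nonneg (sq_nonneg z)]
    exact mul_le_mul (hda a) (hsq hz) (sq_nonneg _) (by norm_num)
  have hjg : ∀ (a : Fin 4) (z : ℝ), |z| ≤ ι → |α₀ a a i₀ (0, 0, 1) * z ^ 2| ≤ ι ^ 2 := fun a z hz => by
    rw [abs_mul, abs_of_nonneg (sq_nonneg z)]
    calc |α₀ a a i₀ (0, 0, 1)| * z ^ 2 ≤ 1 * ι ^ 2 :=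
        mul_le_mul (hα1 a a i₀ _) (hsq hz) (sq_nonneg _) (by norm_num)
      _ = ι ^ 2 := one_mul _
  set R₁ : ℝ := ∑ a, d a 0 * S a k t ^ 2 - d i₁ 0 * S i₁ k t ^ 2 with hR₁
  set R₂ : ℝ := ∑ a, α₀ a a i₀ (0, 0, 1) * S a (k - 1) t ^ 2 - d i₁ 0 * S i₁ (k - 1) t ^ 2 with hR₂
  have hB₁ : |R₁| ≤ 4 * ι ^ 2 := by
    have h := htcLC_sum_split (fun a => d a 0 * S a k t ^ 2) hne (B := 2 * ι ^ 2)
      (fun a h0 h1 => hjd a _ (hjk a h0 h1))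
    have key : R₁ = ∑ a, d a 0 * S a k t ^ 2 - d i₀ 0 * S i₀ k t ^ 2 - d i₁ 0 * S i₁ k t ^ 2 := by
      rw [hR₁, hd0]; ring
    rw [key]; linarith
  have hB₂ : |R₂| ≤ 2 * ι ^ 2 := by
    have h := htcLC_sum_split (fun a => α₀ a a i₀ (0, 0, 1) * S a (k - 1) t ^ 2) hne (B := ι ^ 2)
      (fun a h0 h1 => hjg a _ (hjm a h0 h1))
    have key : R₂ = ∑ a, α₀ a a i₀ (0, 0, 1) * S a (k - 1) t ^ 2 -
        α₀ i₀ i₀ i₀ (0, 0, 1) * S i₀ (k - 1) t ^ 2 - α₀ i₁ i₁ i₀ (0, 0, 1) * S i₁ (k - 1) t ^ 2 := by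
      rw [hR₂, hg0, hg]; ring
    rw [key]; linarith
  have heq : quadTerm 1 α₀ S i₀ k t + β * quadTerm 1 σ S i₀ k t =
      -(γ₀ * (d i₁ 0 * S i₁ k t ^ 2 + R₁)) + γ₁ * (d i₁ 0 * S i₁ (k - 1) t ^ 2 + R₂) +
        β * quadTerm 1 σ S i₀ k t := by
    rw [hx, hR₁, hR₂]; ring
  show |quadTerm 1 α₀ S i₀ k t + β * quadTerm 1 σ S i₀ k t| ≤ _
  rw [heq]
  have hv2 : S i₁ k t ^ 2 ≤ V ^ 2 := by
    have := hV t ht; have := abs_nonneg (S i₁ k t); nlinarith [sq_abs (S i₁ k t)]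
  have hu2 : S i₁ (k - 1) t ^ 2 ≤ U ^ 2 := by
    have := hU t ht; have := abs_nonneg (S i₁ (k - 1) t); nlinarith [sq_abs (S i₁ (k - 1) t)]
  have h1 : |γ₀ * (d i₁ 0 * S i₁ k t ^ 2 + R₁)| ≤ γ₀ * (2 * V ^ 2 + 4 * ι ^ 2) := by
    rw [abs_mul, abs_of_nonneg hγ₀0]
    refine mul_le_mul_of_nonneg_left ?_ hγ₀0
    have hp : d i₁ 0 * S i₁ k t ^ 2 ≤ 2 * V ^ 2 := mul_le_mul he2 hv2 (sq_nonneg _) (by norm_num)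
    have hnn : 0 ≤ d i₁ 0 * S i₁ k t ^ 2 := mul_nonneg he.le (sq_nonneg _)
    calc _ ≤ |d i₁ 0 * S i₁ k t ^ 2| + |R₁| := abs_add_le _ _
      _ ≤ _ := by rw [abs_of_nonneg hnn]; linarith
  have h2 : |γ₁ * (d i₁ 0 * S i₁ (k - 1) t ^ 2 + R₂)| ≤ γ₁ * (2 * U ^ 2 + 2 * ι ^ 2) := by
    rw [abs_mul, abs_of_nonneg hγ₁0]
    refine mul_le_mul_of_nonneg_left ?_ hγ₁0
    have hp : d i₁ 0 * S i₁ (k - 1) t ^ 2 ≤ 2 * U ^ 2 := mul_le_mul he2 hu2 (sq_nonneg _) (by norm_num)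
    have hnn : 0 ≤ d i₁ 0 * S i₁ (k - 1) t ^ 2 := mul_nonneg he.le (sq_nonneg _)
    calc _ ≤ |d i₁ 0 * S i₁ (k - 1) t ^ 2| + |R₂| := abs_add_le _ _
      _ ≤ _ := by rw [abs_of_nonneg hnn]; linarith
  have h3 : |β * quadTerm 1 σ S i₀ k t| ≤ β * Bσ := by
    rw [abs_mul, abs_of_nonneg hβ]; exact mul_le_mul_of_nonneg_left (hB t ht) hβ
  calc |-(γ₀ * (d i₁ 0 * S i₁ k t ^ 2 + R₁)) + γ₁ * (d i₁ 0 * S i₁ (k - 1) t ^ 2 + R₂) +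
        β * quadTerm 1 σ S i₀ k t|
      ≤ |-(γ₀ * (d i₁ 0 * S i₁ k t ^ 2 + R₁)) + γ₁ * (d i₁ 0 * S i₁ (k - 1) t ^ 2 + R₂)| +
        |β * quadTerm 1 σ S i₀ k t| := abs_add_le _ _
    _ ≤ |-(γ₀ * (d i₁ 0 * S i₁ k t ^ 2 + R₁))| + |γ₁ * (d i₁ 0 * S i₁ (k - 1) t ^ 2 + R₂)| +
        |β * quadTerm 1 σ S i₀ k t| := by
          linarith [abs_add_le (-(γ₀ * (d i₁ 0 * S i₁ k t ^ 2 + R₁)))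
            (γ₁ * (d i₁ 0 * S i₁ (k - 1) t ^ 2 + R₂))]
    _ ≤ _ := by rw [abs_neg]; linarith

/-- **Tail trigger (Grönwall).** Setting of `htcLT_seed_row_shell` at shell `k`, plus `Y ≥ |S_{i₀,k}|`,
`X ≥ |S_{i₀,k−1}|` on the window. Then for `t ∈ [0,T]`:
`|S_{i₁,k}(t)| ≤ gronwallBound |S_{i₁,k}(0)| K src t` with `K = 2^{5k/2}·2Y`,
`src = 2^{5(k−1)/2}·β·2σ̄·X·U + Φ`, `Φ` the remainder bound of the seed row. [this file] -/
theorem htcTA_tail_trigger (α₀ σ : Fin 4 → Fin 4 → Fin 4 → ℤ × ℤ × ℤ → ℝ) (i₀ i₁ : Fin 4)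
    (d : Fin 4 → ℤ → ℝ) (hne : i₀ ≠ i₁)
    (hsym : IsSymmetricCoeff α₀) (hcanc : IsCancellingCoeff α₀)
    (hpure : ∀ X : Fin 4 → ℤ → ℝ → ℝ, (∀ i n t, i ≠ i₀ → X i n t = 0) →
      ∀ i n t, quadTerm 1 α₀ X i n t = 0)
    (hsad : ∀ (Y : Fin 4 → ℤ → ℝ → ℝ) (i : Fin 4) (n : ℤ) (t : ℝ),
      quadTerm 1 α₀ (fun j m s => (fun j m (_ : ℝ) => if j = i₀ ∧ m = 0 then (1 : ℝ) else 0) j m s +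
          Y j m s) i n t -
        quadTerm 1 α₀ (fun j m (_ : ℝ) => if j = i₀ ∧ m = 0 then (1 : ℝ) else 0) i n t -
        quadTerm 1 α₀ Y i n t = d i n * Y i n t)
    (hpar : ∀ (j₁ j₂ j₃ : Fin 4) (μ : ℤ × ℤ × ℤ),
      Xor (Xor (j₁ = i₁) (j₂ = i₁)) (j₃ = i₁) → α₀ j₁ j₂ j₃ μ = 0)
    (hα1 : ∀ a b c μ, |α₀ a b c μ| ≤ 1)
    (hσsym : IsSymmetricCoeff σ)
    (hσpar : ∀ (j₁ j₂ j₃ : Fin 4) (μ : ℤ × ℤ × ℤ),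
      Xor (Xor (j₁ = i₁) (j₂ = i₁)) (j₃ = i₁) → σ j₁ j₂ j₃ μ = 0)
    {σb : ℝ} (hσ1 : ∀ a b c μ, |σ a b c μ| ≤ σb) (he : 0 < d i₁ 0)
    (β : ℝ) (hβ : 0 ≤ β) (S : Fin 4 → ℤ → ℝ → ℝ) {T : ℝ} (k : ℤ)
    (hS : ∀ i k, ∀ t ∈ Icc 0 T, HasDerivWithinAt (S i k)
      (quadTerm 1 α₀ S i k t + β * quadTerm 1 σ S i k t) (Icc 0 T) t)
    {M V ι Z A₁ Y X : ℝ}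
    (hMu : ∀ t ∈ Icc 0 T, |S i₁ (k - 1) t| ≤ M) (hV : ∀ t ∈ Icc 0 T, |S i₁ k t| ≤ V)
    (hZ : ∀ t ∈ Icc 0 T, ∀ b, |S b (k + 1) t| ≤ Z) (hA : ∀ t ∈ Icc 0 T, ∀ b, |S b k t| ≤ A₁)
    (hι : ∀ t ∈ Icc 0 T, ∀ a, a ≠ i₀ → a ≠ i₁ → |S a (k - 1) t| ≤ ι ∧ |S a k t| ≤ ι)
    (hY : ∀ t ∈ Icc 0 T, |S i₀ k t| ≤ Y) (hX : ∀ t ∈ Icc 0 T, |S i₀ (k - 1) t| ≤ X) :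
    ∀ t ∈ Icc 0 T, |S i₁ k t| ≤ gronwallBound |S i₁ k 0|
      ((1 + 1 : ℝ) ^ ((5 : ℝ) * k / 2) * 2 * Y)
      ((1 + 1 : ℝ) ^ ((5 : ℝ) * ((k : ℝ) - 1) / 2) * (β * (2 * σb) * X * M) +
        ((1 + 1 : ℝ) ^ ((5 : ℝ) * k / 2) *
            (2 * V * (2 * ι + 4 * Z + 4 * β * σb * (A₁ + Z)) + 2 * Z * (2 * ι + 4 * β * σb * A₁)) +
          (1 + 1 : ℝ) ^ ((5 : ℝ) * ((k : ℝ) - 1) / 2) * (4 * M * ι * (1 + β * σb)))) t := by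
  obtain ⟨fv, hv, hfv⟩ := htcLT_seed_row_shell α₀ σ i₀ i₁ d hne hsym hcanc hpure hsad hpar hα1 hσsym
    hσpar hσ1 β hβ S k hS hMu hV hZ hA hι
  obtain ⟨-, -, -, nf4, -, -, -, -, -⟩ :=
    HeteroclinicTriggerChain.stub_normal_form α₀ i₀ d hsym hcanc hpure hsad
  have he2 : d i₁ 0 ≤ 2 := by
    rw [nf4 i₁]; have := (abs_le.1 (hα1 i₀ i₁ i₁ (0, 0, 0))).2; linarith
  have hσ0 : 0 ≤ σb := (abs_nonneg _).trans (hσ1 i₀ i₀ i₀ (0, 0, 0))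
  set γ₀ : ℝ := (1 + 1 : ℝ) ^ ((5 : ℝ) * k / 2) with hγ₀
  set γ₁ : ℝ := (1 + 1 : ℝ) ^ ((5 : ℝ) * ((k : ℝ) - 1) / 2) with hγ₁
  have hγ₀0 : 0 ≤ γ₀ := Real.rpow_nonneg (by norm_num) _
  have hγ₁0 : 0 ≤ γ₁ := Real.rpow_nonneg (by norm_num) _
  have hvc : ContinuousOn (S i₁ k) (Icc 0 T) := fun s hs => (hv s hs).continuousWithinAt
  have hv' : ∀ s ∈ Ico 0 T, HasDerivWithinAt (S i₁ k)
      (γ₀ * d i₁ 0 * S i₀ k s * S i₁ k s +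
        γ₁ * (β * (2 * σ i₁ i₀ i₁ (0, 0, 1)) * S i₀ (k - 1) s * S i₁ (k - 1) s) + fv s) (Ici s) s :=
    fun s hs => (hv s (Ico_subset_Icc_self hs)).mono_of_mem_nhdsWithin (Icc_mem_nhdsGE_of_mem hs)
  intro t ht
  have hg := norm_le_gronwallBound_of_norm_deriv_right_le (a := 0) (b := T) (δ := |S i₁ k 0|)
    (K := γ₀ * 2 * Y)
    (ε := γ₁ * (β * (2 * σb) * X * M) +
      (γ₀ * (2 * V * (2 * ι + 4 * Z + 4 * β * σb * (A₁ + Z)) + 2 * Z * (2 * ι + 4 * β * σb * A₁)) +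
        γ₁ * (4 * M * ι * (1 + β * σb))))
    hvc hv' (by rw [Real.norm_eq_abs])
    (fun s hs => by
      have hs' := Ico_subset_Icc_self hs
      rw [Real.norm_eq_abs, Real.norm_eq_abs]
      -- rate term
      have h1 : |γ₀ * d i₁ 0 * S i₀ k s * S i₁ k s| ≤ γ₀ * 2 * Y * |S i₁ k s| := by
        rw [abs_mul, abs_mul, abs_mul, abs_of_nonneg hγ₀0, abs_of_pos he]
        have := hY s hs'
        have h' : γ₀ * d i₁ 0 * |S i₀ k s| ≤ γ₀ * 2 * Y := by
          have := mul_le_mul he2 this (abs_nonneg _) (by norm_num)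
          nlinarith
        exact mul_le_mul_of_nonneg_right h' (abs_nonneg _)
      -- seed term
      have h2 : |γ₁ * (β * (2 * σ i₁ i₀ i₁ (0, 0, 1)) * S i₀ (k - 1) s * S i₁ (k - 1) s)| ≤
          γ₁ * (β * (2 * σb) * X * M) := by
        rw [abs_mul, abs_of_nonneg hγ₁0]
        refine mul_le_mul_of_nonneg_left ?_ hγ₁0
        rw [abs_mul, abs_mul, abs_mul, abs_of_nonneg hβ, abs_mul, abs_two]
        have hs1 : |σ i₁ i₀ i₁ (0, 0, 1)| ≤ σb := hσ1 _ _ _ _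
        have hx := hX s hs'
        have hu := hMu s hs'
        have hX0 : 0 ≤ X := (abs_nonneg _).trans hx
        have : β * (2 * |σ i₁ i₀ i₁ (0, 0, 1)|) * |S i₀ (k - 1) s| ≤ β * (2 * σb) * X :=
          mul_le_mul (mul_le_mul_of_nonneg_left (by linarith) hβ) hx (abs_nonneg _) (by positivity)
        exact mul_le_mul this hu (abs_nonneg _) (by positivity)
      have h3 := hfv s hs'
      calc |γ₀ * d i₁ 0 * S i₀ k s * S i₁ k s +
            γ₁ * (β * (2 * σ i₁ i₀ i₁ (0, 0, 1)) * S i₀ (k - 1) s * S i₁ (k - 1) s) + fv s|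
          ≤ |γ₀ * d i₁ 0 * S i₀ k s * S i₁ k s +
              γ₁ * (β * (2 * σ i₁ i₀ i₁ (0, 0, 1)) * S i₀ (k - 1) s * S i₁ (k - 1) s)| + |fv s| :=
            abs_add_le _ _
        _ ≤ |γ₀ * d i₁ 0 * S i₀ k s * S i₁ k s| +
              |γ₁ * (β * (2 * σ i₁ i₀ i₁ (0, 0, 1)) * S i₀ (k - 1) s * S i₁ (k - 1) s)| + |fv s| := by
            linarith [abs_add_le (γ₀ * d i₁ 0 * S i₀ k s * S i₁ k s)
              (γ₁ * (β * (2 * σ i₁ i₀ i₁ (0, 0, 1)) * S i₀ (k - 1) s * S i₁ (k - 1) s))]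
        _ ≤ γ₀ * 2 * Y * |S i₁ k s| + (γ₁ * (β * (2 * σb) * X * M) +
            (γ₀ * (2 * V * (2 * ι + 4 * Z + 4 * β * σb * (A₁ + Z)) + 2 * Z * (2 * ι + 4 * β * σb * A₁)) +
              γ₁ * (4 * M * ι * (1 + β * σb)))) := by linarith)
    t ht
  rw [Real.norm_eq_abs, sub_zero] at hg
  exact hg

end Summit.NavierStokesRegularity.NavierStokesRegularity.Theorems

end
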